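import Literature.NumberTheory.Automorphic.ArtinLFunctionsProofs
import Literature.NumberTheory.Automorphic.BookerStrongArtin
import HarnessLib

/-!
# Odd two-dimensional Artin representations of `Γ_ℚ` are modular of weight one
(Khare–Wintenberger), and Artin's conjecture for them

Topic `NumberTheory/Automorphic`. Two NAMED FACTS (D-0014, `def … : Prop`, statement only) and
their proved glue to the tree's Langlands–Tunnell and Booker vocabulary.

* `khareWintenberger_weightOne_of_isOdd ρ` — for a continuous irreducible ODD
  `ρ : Γ_ℚ → GL₂(ℂ)` (any projective type, in particular icosahedral) there is a weight-one
  newform `f` with `ρ ↔ f` away from the level: exactly the conclusion of the tree's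
  `langlands_tunnell ρ` (lang.S30) with the solvability hypothesis REMOVED.
* `khareWintenberger_artinConjecture_of_isOdd` — Artin's conjecture (entire continuation of
  `L(s, ρ)`) for every such `ρ`: the conclusion of the tree's
  `hasEntireContinuation_artinLFunction_of_isSolvable ρ` with solvability removed. It is the
  printed corollary of the first fact and is DISCHARGED from it (+ the Deligne–Serre comparison
  `artinLFunction_eq_cuspFormLSeries`, Hecke proved) by
  `khareWintenberger_artinConjecture_of_isOdd_of_weightOne`, so the file carries ONE debt (D-0026).

## Sources (read 2026-08-15, page-level)

* C. Khare, J.-P. Wintenberger, *Serre's modularity conjecture (I)*, Invent. Math. 178 (2009)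
  485–504, §10 "Modularity of compatible systems", printed p. 18: "**Theorem 10.1.** (i) A
  (2-dimensional) regular compatible system that is irreducible and odd arises up to twist from a
  newform of weight ≥ 2. (ii) An (2-dimensional) irregular compatible system that is irreducible
  and odd arises up to twist from a newform of weight 1." and, after the proof: "Part (ii)
  implies Artin's conjecture for odd irreducible 2-dimensional representations of `G_ℚ`, but is
  not implied by it: thus we rederive by a different method Theorem A of [1]" ([1] = BDST 2001).
  Theorem 10.1 is stated as a corollary of Serre's conjecture = Thm. 1.2 and Thm. 9.1 of the paper
  (the latter under Hypothesis (H) = Kisin, Invent. Math. 178 (2009), Thm. 0.1 / Cor. 0.2; in the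
  tree: the named fact `khare_wintenberger p k` of `Automorphic/SerreConjecture`).
* K. Buzzard, M. Dickinson, N. Shepherd-Barron, R. Taylor, *On icosahedral Artin
  representations*, Duke Math. J. 109 (2001), Theorem A (printed p. 284): "Suppose that
  `ρ : Gal(ℚ^ac/ℚ) → GL₂(ℂ)` is a continuous irreducible representation and that `ρ` is odd … [if
  `ρ` is icosahedral suppose that proj `ρ` is unramified at 2 and that the image of a Frobenius
  element at 2 under proj `ρ` has order 3, and proj `ρ` is unramified at 5.] Then there is a weight
  one newform `f` such that for all prime numbers `p` the `p`th Fourier coefficient of `f` equals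
  the trace of Frobenius at `p` on the inertia at `p` coinvariants of `ρ`. In particular the Artin
  L-series for `ρ` is the Mellin transform of a weight one newform and is an entire function." —
  the SHAPE of both facts below; Khare–Wintenberger remove the bracketed local hypotheses.
* F. Calegari, *Reciprocity in the Langlands program since Fermat's Last Theorem*, ICM 2022
  (2023), §4 p. 618 ("the `n = 2` Artin conjecture for totally real fields is now completely
  resolved under the additional assumption that the representation is odd"; over `ℚ`: "the
  deduction of the Artin conjecture from Serre's conjecture for GL₂", p. 640 fn. 55) and §12
  p. 641: the EVEN icosahedral case is open ("we cannot establish the Artin conjecture for a single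
  Galois representation whose image is the binary icosahedral group").

## Rendering and what is NOT claimed

* "Arises from a newform of weight 1" is rendered, as for `langlands_tunnell`, by the tree's
  `IsGaloisRepOfNewform1 f (algebraMap K_f ℂ) {p ∣ N} ρ` (`EllipticCurves/NewformGaloisRep`):
  for every prime `p ∤ N`, `ρ` is unramified at `p` and every arithmetic Frobenius at `p` has
  characteristic polynomial the Hecke polynomial `X² − a_p X + ε(p)` of `f` (weight `k = 1`).
  The printed "up to twist" of Thm. 10.1(ii) is absorbed: for a finite-image `ρ` the twist is by
  a finite-order character `χ`, and `ρ ≅ ρ_g ⊗ χ⁻¹ = ρ_{g ⊗ χ⁻¹}` with the newform attached to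
  `g ⊗ χ⁻¹` again of weight one (standard; this is how the authors read (ii) as "Theorem A of
  [BDST] without hypotheses"). Equality of traces at all unramified `p` for irreducible `ρ` is
  equivalent to `ρ ≅ ρ_f` (Chebotarev + Brauer–Nesbitt), whence the charpoly form.
* The automorphic ("`π = π(ρ)`", `IsPiOfArtinRep`) form is NOT restated as a third fact: over `ℚ`
  it follows from `khareWintenberger_artinConjecture_of_isOdd` and the tree's
  `booker_strongArtin_of_artinConjecture` (Booker 2003, Corollary) — proved below as
  `strongArtin_ae_of_isOdd` — or from the weight-one dictionary.
* Base field `ℚ` only. Over totally real `F` the odd case is also a theorem (Pilloni–Stroh,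
  Kassaei–Sasaki–Tian, Sasaki; Calegari 2023 §4) but is not vendored here. The EVEN case
  (projective image `A₅`, `det ρ(c) = +1`) is OPEN and is not asserted anywhere in this file.
* Mathlib has no Artin representations / newforms; nothing here duplicates Mathlib. The tree's
  `langlands_tunnell`, `hasEntireContinuation_artinLFunction_of_isSolvable` (solvable image) and
  `booker_strongArtin_of_artinConjecture` are the neighbouring facts; the two facts below are
  strictly stronger than the first two (hypothesis dropped) and are the missing input of the third.
-/

noncomputable section

open scoped MatrixGroups ModularForm NumberField
open CongruenceSubgroup NumberField IsDedekindDomain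

namespace Literature.NumberTheory.Automorphic

open EllipticCurves.ModularForms GaloisRepresentations

/-- **Odd two-dimensional complex representations of `Γ_ℚ` are modular of weight one**
(Khare–Wintenberger, Invent. Math. 178 (2009), Thm. 10.1(ii) with the remark following its proof,
p. 18; the statement shape is Theorem A of Buzzard–Dickinson–Shepherd-Barron–Taylor, Duke
Math. J. 109 (2001), whose local hypotheses at 2 and 5 Khare–Wintenberger remove). For a
continuous `ρ : Γ_ℚ → GL₂(ℂ)`: *if `ρ` is irreducible and odd, then there are a level `N ≥ 1`
and a weight-one newform `f ∈ S₁(Γ₁(N))` such that for every prime `p ∤ N`, `ρ` is unramified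
at `p` and `charpoly ρ(Frob_p) = X² − a_p(f) X + ε_f(p)`* (`IsGaloisRepOfNewform1`, coefficients
embedded by `algebraMap K_f ℂ`). This is `langlands_tunnell ρ` for every `ρ`, without its
solvability hypothesis; any projective type (dihedral, `A₄`, `S₄`, `A₅`) is allowed. Named fact
(D-0014), CLOSED over `ρ` (it is the one counted debt of this file); users take
`(h : khareWintenberger_weightOne_of_isOdd)`. Grounds the
odd half of the route item `Summit.Langlands.Langlands.Theses.GaloisWeightedBE.StrongArtinIcosahedralQ`
(even icosahedral `ρ`: open).
[cite: KhareWintenberger2009, Thm. 10.1(ii) and remark p. 18] [cite: BuzzardEtAl2001, Thm. A] -/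
def khareWintenberger_weightOne_of_isOdd : Prop :=
  ∀ (ρ : GaloisRepresentations.FramedArtinRep ℚ 2), ρ.toGaloisRep.IsIrreducible → ρ.IsOdd →
    ∃ (N : ℕ) (_ : NeZero N) (f : CuspForm (Gamma1 N) 1),
      IsNewform1 f ∧ IsGaloisRepOfNewform1 f (algebraMap (coeffCharField f) ℂ) {p | p ∣ N} ρ

/-- **Artin's conjecture for odd two-dimensional representations of `Γ_ℚ`**
(Khare–Wintenberger, Invent. Math. 178 (2009), §10, p. 18: "Part (ii) [of Theorem 10.1] implies
Artin's conjecture for odd irreducible 2-dimensional representations of `G_ℚ`"; the "in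
particular" clause of Theorem A of Buzzard–Dickinson–Shepherd-Barron–Taylor 2001: "the Artin
L-series for `ρ` is the Mellin transform of a weight one newform and is an entire function").
For every continuous irreducible odd `ρ : Γ_ℚ → GL₂(ℂ)` the Artin L-function `L(s, ρ)`
(`GaloisRepresentations.artinLFunction ρ.toArtinRep`) has an entire continuation
(`GaloisRepresentations.LFunction.HasEntireContinuation`). This is
`hasEntireContinuation_artinLFunction_of_isSolvable ρ` for every `ρ`, without solvability. In print
AND in the tree it is a COROLLARY of `khareWintenberger_weightOne_of_isOdd`: it is discharged from
that fact and the Deligne–Serre comparison `artinLFunction_eq_cuspFormLSeries` (Hecke's theorem for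
weight one being proved) by `khareWintenberger_artinConjecture_of_isOdd_of_weightOne` below —
exactly as `langlands_tunnell_hasEntireContinuation_of_langlands_tunnell`
(`ArtinLFunctionsProofs`) discharges the Artin side of lang.S30 — so it adds no independent debt.
Kept as a named `Prop` because it is exactly the hypothesis of the tree's
`booker_strongArtin_of_artinConjecture` in the odd case (see `strongArtin_ae_of_isOdd`, which
grounds the odd half of `Summit.Langlands.Langlands.Theses.GaloisWeightedBE.StrongArtinIcosahedralQ`).
[cite: KhareWintenberger2009, §10 p. 18 (after Thm. 10.1)] [cite: BuzzardEtAl2001, Thm. A] -/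
def khareWintenberger_artinConjecture_of_isOdd : Prop :=
  ∀ (ρ : GaloisRepresentations.FramedArtinRep ℚ 2), ρ.toGaloisRep.IsIrreducible → ρ.IsOdd →
    GaloisRepresentations.LFunction.HasEntireContinuation
      (GaloisRepresentations.artinLFunction ρ.toArtinRep)

/-! ### Glue (proved) -/

/-- The weight-one modularity of all odd `ρ` gives the Langlands–Tunnell statement
`langlands_tunnell ρ` (lang.S30) by forgetting the solvability hypothesis. [folklore] -/
theorem langlands_tunnell_of_weightOne_of_isOdd (h : khareWintenberger_weightOne_of_isOdd)
    (ρ : GaloisRepresentations.FramedArtinRep ℚ 2) : langlands_tunnell ρ :=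
  fun hirr hodd _ => h ρ hirr hodd

/-- **The Artin-conjecture corollary is discharged by the weight-one fact** (Khare–Wintenberger
2009, p. 18: "Part (ii) implies Artin's conjecture for odd irreducible 2-dimensional
representations of `G_ℚ`"), through the tree's Deligne–Serre + Hecke step
`hasEntireContinuation_artinLFunction_of_isGaloisRepOfNewform1` (`ArtinLFunctionsProofs`): granted
weight-one modularity of every odd irreducible `ρ` and the comparison
`artinLFunction_eq_cuspFormLSeries` (`L(s, ρ) = L(s, f)` on `Re s > 1`) for every level, newform and
`ρ`, the Artin L-function of every such `ρ` is entire. Same argument as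
`langlands_tunnell_hasEntireContinuation_of_langlands_tunnell`.
[cite: KhareWintenberger2009, §10 p. 18 (after Thm. 10.1)]
[cite: DeligneSerreASENS1974, Thm. 4.1 and Thm. 4.6 (b)] -/
theorem khareWintenberger_artinConjecture_of_isOdd_of_weightOne
    (hKW : khareWintenberger_weightOne_of_isOdd)
    (hDS : ∀ {N : ℕ} [NeZero N] {f : CuspForm (Gamma1 N) 1}
      {ρ : GaloisRepresentations.FramedArtinRep ℚ 2},
      artinLFunction_eq_cuspFormLSeries (f := f) (ρ := ρ)) :
    khareWintenberger_artinConjecture_of_isOdd := by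
  intro ρ hirr hodd
  obtain ⟨N, _, f, hf, hρ⟩ := hKW ρ hirr hodd
  exact hasEntireContinuation_artinLFunction_of_isGaloisRepOfNewform1 hDS hf hρ

/-- Artin's conjecture for all odd `ρ` gives the solvable-image "hence" clause
`hasEntireContinuation_artinLFunction_of_isSolvable ρ` by forgetting solvability. [folklore] -/
theorem hasEntireContinuation_artinLFunction_of_isSolvable_of_isOdd
    (h : khareWintenberger_artinConjecture_of_isOdd)
    (ρ : GaloisRepresentations.FramedArtinRep ℚ 2) :
    hasEntireContinuation_artinLFunction_of_isSolvable ρ :=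
  fun hirr hodd _ => h ρ hirr hodd

/-- **Strong Artin for odd `ρ : Γ_ℚ → GL₂(ℂ)` in Tunnell's almost-everywhere form**, from the two
named facts `khareWintenberger_artinConjecture_of_isOdd` (Artin's conjecture for odd `ρ`) and
`booker_strongArtin_of_artinConjecture` (Booker 2003, Corollary: Artin ⇒ strong Artin over `ℚ`):
there are a compactness witness and a cuspidal automorphic representation `π` of `GL₂(𝔸_ℚ)` such
that for all but finitely many finite places `v`, `π` has a Satake parameter `α` at `v`, `ρ` is
unramified at `v` and every arithmetic Frobenius at `v` has characteristic polynomial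
`satakePolynomial α` (the definiens of `IsPiOfArtinRep ρ π.1`). In particular this covers every
ODD icosahedral `ρ`; the even icosahedral case remains open. [folklore] -/
theorem strongArtin_ae_of_isOdd (hKW : khareWintenberger_artinConjecture_of_isOdd)
    (hB : booker_strongArtin_of_artinConjecture)
    (ρ : GaloisRepresentations.FramedArtinRep ℚ 2) (hirr : ρ.toGaloisRep.IsIrreducible)
    (hodd : ρ.IsOdd) :
    ∃ (hcpt : isCompact_glFiniteIntegralLevel 2 ℚ) (π : CuspidalAutomorphicRepData 2 ℚ hcpt),
      ∀ᶠ v : HeightOneSpectrum (𝓞 ℚ) in Filter.cofinite,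
        ∃ α : Multiset ℂ, π.1.HasSatakeParamAt v α ∧ ρ.IsUnramifiedAt v ∧
          ρ.HasFrobCharpolyAt v (satakePolynomial α) :=
  hB ρ hirr (hKW ρ hirr hodd)

end Literature.NumberTheory.Automorphic

end
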